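import Literature.Computability.AlgebraicComplexity.MS21ANFDiagonalScalingHitting
import Literature.Computability.AlgebraicComplexity.MS21ANFSeparation
import HarnessLib

/-!
# Medini–Shpilka 2021, Thm 35 (`thm:pitRoanf`), `Δ₁ = Δ₂`: assembly of the homogeneous core from
# the §5.2 bricks, field by field

`MS2021_thm_35_of_core` (`MS21ANFOrbitsSameDepthReduction`) reduces the typed literature statement
`MS2021_thm_35` to its homogeneous core: for `M ∈ GL_{4^Δ}(K)` not a symmetry of `ANF_Δ` and
`A ∈ GL_n(K)`, every uniform `(2Δ+7)`-independent `G` hits `(ANF_Δ(My) - ANF_Δ(y))(Ax)`.  This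
file assembles that core, FOR A FIXED FIELD `K` AND DEPTH `Δ`, from the three printed bricks of
[MS21, §5.2] taken as explicit hypotheses (no definitions, no new named facts, D-0026):

* `h512` = **Lemma 5.12** (`lem:roanfMonInc`, arXiv p0027:L32–p0028) in the TR-free form of the
  cell's sizing memo: `mon(ANF_Δ(My)) ⊆ mon(ANF_Δ(y))` ⇒ `ANF_Δ(My) = ANF_Δ(α · y_π)` with `π` a
  symmetry of `ANF_Δ` and all `α_i ≠ 0` (in flight, seat p1);
* `h513` = **Lemma 5.13** core (`lem:separateRoanfSum`, p0029:L3–L13): `mon(ANF_Δ(My)) ⊄ mon(ANF_Δ)`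
  ⇒ `∃ i j, ∂_i∂_j ANF_Δ = 0 ≠ ∂_i∂_j ANF_Δ(My)` — IN THE TREE under the exponent hypothesis
  `hK : ∀ 1 ≤ m ≤ 2^Δ, (m : K) ≠ 0` (`MS2021.exists_pderiv_pderiv_anf_separates_linSubst`,
  `MS21ANFSeparation`); the printed lemma is false in characteristic `2` (registry B36), so the
  all-fields core waits on a repair of THIS brick only;
* `hL2D` = **Lemmas 5.14 + 5.15** (`lem:hitSecondDeriv` + `lem:pitDerivRoanf`, p0029:L14–p0030:L26)
  as a second-order engine: a nonzero `Σ_{a,b} α_{ab} ∂_a∂_b ANF_Δ`, composed with any invertible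
  affine map, survives every `B`-independent map with `B ≥ t + 5`, `4^Δ ≤ 2^t` (in flight, seat t24).

Given these, `MS2021.thm35Core_of_bricks` proves the core at `(K, Δ)` by the printed case analysis
(p0030:L33–L55 with §5.2.2): Case (ii) `mon ⊆ mon`: `h512`, the symmetry `π` is absorbed
(`aeval_scale_perm_eq`), and the diagonal Lemma `pitRoanfSame`
(`bind₁_affSubst_scale_anf_sub_anf_ne_zero`, char-free, `MS21ANFDiagonalScalingHitting`) hits;
Case (i) `mon ⊄ mon`: `h513` gives `∂_i∂_j (ANF(My) - ANF(y)) = ∂_i∂_j ANF(My) =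
(Σ_{a,b} M_{ai}M_{bj} ∂_a∂_b ANF)(My) ≠ 0` (`pderiv_pderiv_affSubst_refl`), the inner `GL_{4^Δ}` is
absorbed into the outer affine map (`exists_affSubst_affSubst_eq`: affine orbits are closed under
the inner linear group), two dual-direction derivatives are peeled (Lemmas 3.8/3.9,
`hit_affSubst_of_hit_pderivs`) and `hL2D` hits.  Then `MS2021_thm_35_sameDepth_of_core` turns the
core at `(K, Δ)` into the typed statement at `(K, Δ, Δ)` (the case analysis of
`MS2021_thm_35_of_core`, now field by field), `MS2021_thm_35_sameDepth_of_bricks` composes, and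
`MS2021_thm_35_sameDepth_of_bricks_of_cast_ne_zero` discharges `h513` by the tree's Lemma 5.13 under
`hK` — so that `MS2021_thm_35` for `char K = 0` or `char K > 2^Δ` follows BY NAME from `h512` and
`hL2D` alone.  `MS2021_thm_35_of_bricks` is the all-fields form (needs the all-fields `h513`).

HONEST FRAMING: conditional assembly; the hypotheses `h512`, `hL2D` (and `h513` without `hK`) are
NOT proved here.  `VP ≠ VNP` is NOT proved and nothing in this file bears on it.

## References
* [MediniShpilka2021] D. Medini, A. Shpilka, CCC 2021 (LIPIcs 200:19) = arXiv:2102.05632: Thm 35 and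
  its proof (§5.2, arXiv p0030:L28–p0031:L24), Lemmas 5.12–5.15 (p0027:L32–p0030:L26), §1.1.6.
-/

noncomputable section

open MvPolynomial
open scoped Matrix

namespace Literature.Computability.AlgebraicComplexity

namespace MS2021

/-! ### Affine orbits are closed under the inner linear group `GL_{m}(K)` -/

section InnerLinear

variable {K : Type*} [Field K] {m n : ℕ}

/-- A sum over `Fin n` whose terms vanish at the indices `≥ m` is the sum over `castLE`.
[folklore] -/
private theorem sum_eq_sum_castLE' (h : m ≤ n) {β : Type*} [AddCommMonoid β] (F : Fin n → β)
    (hF : ∀ l : Fin n, m ≤ (l : ℕ) → F l = 0) : ∑ l, F l = ∑ j : Fin m, F (Fin.castLE h j) := by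
  classical
  have hmap : ∑ j : Fin m, F (Fin.castLE h j) = ∑ l ∈ Finset.univ.map (Fin.castLEEmb h), F l := by
    rw [Finset.sum_map]
    rfl
  rw [hmap]
  symm
  apply Finset.sum_subset (Finset.subset_univ _)
  intro l _ hl
  apply hF
  by_contra hlt
  push Not at hlt
  exact hl (Finset.mem_map.mpr ⟨⟨l, hlt⟩, Finset.mem_univ _, Fin.ext rfl⟩)

/-- Rows `< m` of the block lift `diag(M, 1) · X`. [folklore] -/
private theorem blockLift_mul_apply_castLE (h : m ≤ n) (M : Matrix (Fin m) (Fin m) K)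
    (X : Matrix (Fin n) (Fin n) K) (i : Fin m) (k : Fin n) :
    ((Matrix.of fun l l' : Fin n =>
        if hl : (l : ℕ) < m then (if hl' : (l' : ℕ) < m then M ⟨l, hl⟩ ⟨l', hl'⟩ else 0)
        else (if l = l' then (1 : K) else 0)) * X) (Fin.castLE h i) k =
      ∑ j, M i j * X (Fin.castLE h j) k := by
  rw [Matrix.mul_apply, sum_eq_sum_castLE' h]
  · refine Finset.sum_congr rfl fun j _ => ?_
    simp only [Matrix.of_apply, Fin.val_castLE, Fin.is_lt, dif_pos, Fin.eta]
  · intro l hl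
    simp only [Matrix.of_apply, Fin.val_castLE, Fin.is_lt, dif_pos, not_lt.mpr hl, dif_neg,
      not_false_eq_true, zero_mul]

/-- Rows `≥ m` of the block lift `diag(M, 1) · X`. [folklore] -/
private theorem blockLift_mul_apply_of_le (M : Matrix (Fin m) (Fin m) K)
    (X : Matrix (Fin n) (Fin n) K) (l : Fin n) (hl : m ≤ (l : ℕ)) (k : Fin n) :
    ((Matrix.of fun l l' : Fin n =>
        if hl : (l : ℕ) < m then (if hl' : (l' : ℕ) < m then M ⟨l, hl⟩ ⟨l', hl'⟩ else 0)
        else (if l = l' then (1 : K) else 0)) * X) l k = X l k := by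
  classical
  rw [Matrix.mul_apply]
  simp only [Matrix.of_apply, not_lt.mpr hl, dif_neg, not_false_eq_true, ite_mul, one_mul,
    zero_mul, Finset.sum_ite_eq, Finset.mem_univ, if_true]

/-- **Affine orbits are closed under the inner linear group**: for `M ∈ GL_m(K)` and an invertible
affine `(A, b)` there is an invertible affine `(A', b')` with `g(M(·))(Ax + b) = g(A'x + b')` for all
`g` (the first `m` rows of `A'` are `M ·` the first `m` rows of `A`).
[cite: MediniShpilka2021, §1.1.6 (the group `GLaff_n(F)` acting; CCC p.19:9); proof of Thm 35, "`T₁(x) = (M m(x), …)`" (arXiv p0030:L40–L43)] -/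
theorem exists_affSubst_affSubst_eq (h : m ≤ n) {A : Matrix (Fin n) (Fin n) K} (hA : IsUnit A.det)
    (b : Fin n → K) (M : Matrix (Fin m) (Fin m) K) (hM : IsUnit M.det) :
    ∃ (A' : Matrix (Fin n) (Fin n) K) (b' : Fin n → K), IsUnit A'.det ∧
      ∀ g : MvPolynomial (Fin m) K,
        affSubst h A b (affSubst le_rfl M 0 g) = affSubst h A' b' g := by
  classical
  -- the lifts of `M` and `M⁻¹`
  set E : Matrix (Fin n) (Fin n) K := Matrix.of fun l l' : Fin n =>
    if hl : (l : ℕ) < m then (if hl' : (l' : ℕ) < m then M ⟨l, hl⟩ ⟨l', hl'⟩ else 0)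
    else (if l = l' then (1 : K) else 0) with hE
  set E' : Matrix (Fin n) (Fin n) K := Matrix.of fun l l' : Fin n =>
    if hl : (l : ℕ) < m then (if hl' : (l' : ℕ) < m then M⁻¹ ⟨l, hl⟩ ⟨l', hl'⟩ else 0)
    else (if l = l' then (1 : K) else 0) with hE'
  set γ : Fin m → K := M *ᵥ fun j => b (Fin.castLE h j) with hγ
  refine ⟨E * A, fun l => if hl : (l : ℕ) < m then γ ⟨l, hl⟩ else 0, ?_, ?_⟩
  · -- `(A⁻¹ E') (E A) = 1`
    apply Matrix.isUnit_det_of_left_inverse (B := A⁻¹ * E')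
    have hEE : E' * (E * A) = A := by
      ext l k
      by_cases hl : (l : ℕ) < m
      · have hl' : l = Fin.castLE h ⟨l, hl⟩ := Fin.ext rfl
        rw [hl', hE', blockLift_mul_apply_castLE]
        simp_rw [hE, blockLift_mul_apply_castLE, Finset.mul_sum, ← mul_assoc]
        rw [Finset.sum_comm]
        simp_rw [← Finset.sum_mul]
        have hMM : ∀ j' : Fin m, (∑ j, M⁻¹ ⟨l, hl⟩ j * M j j') =
            (1 : Matrix (Fin m) (Fin m) K) ⟨l, hl⟩ j' := fun j' => by
          rw [← Matrix.nonsing_inv_mul M hM, Matrix.mul_apply]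
        simp_rw [hMM, Matrix.one_apply, ite_mul, one_mul, zero_mul]
        rw [Finset.sum_ite_eq]
        simp
      · rw [not_lt] at hl
        rw [hE', blockLift_mul_apply_of_le _ _ l hl, hE, blockLift_mul_apply_of_le _ _ l hl]
    rw [Matrix.mul_assoc, hEE, Matrix.nonsing_inv_mul A hA]
  · intro g
    have hone : ∀ (i : Fin m) (k : Fin n),
        A (Fin.castLE h i) k = ∑ j, (1 : Matrix (Fin m) (Fin m) K) i j * A (Fin.castLE h j) k := by
      intro i k
      simp_rw [Matrix.one_apply, ite_mul, one_mul, zero_mul]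
      rw [Finset.sum_ite_eq]
      simp
    have hrows : ∀ (i : Fin m) (k : Fin n),
        (E * A) (Fin.castLE h i) k = ∑ j, M i j * A (Fin.castLE h j) k := by
      intro i k
      rw [hE, blockLift_mul_apply_castLE]
    have hb' : (fun i : Fin m => (fun l : Fin n => if hl : (l : ℕ) < m then γ ⟨l, hl⟩ else 0)
        (Fin.castLE h i)) = γ := by
      funext i
      simp only [Fin.val_castLE, Fin.is_lt, dif_pos, Fin.eta]
    rw [affSubst_eq_affSubst_zero_affSubst h b 1 hone, affSubst_one_affSubst_zero,
      affSubst_eq_affSubst_zero_affSubst h _ M hrows, hb']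

/-- `Σ_k δ_{jk} x_k = x_j`. [folklore] -/
private theorem sum_C_one_mul_X' (j : Fin m) :
    (∑ k : Fin m, C ((1 : Matrix (Fin m) (Fin m) K) j k) * X k : MvPolynomial (Fin m) K) = X j := by
  have hk : ∀ k : Fin m, (C ((1 : Matrix (Fin m) (Fin m) K) j k) * X k : MvPolynomial (Fin m) K) =
      if j = k then X k else 0 := by
    intro k
    rw [Matrix.one_apply]
    split_ifs <;> simp
  simp_rw [hk]
  rw [Finset.sum_ite_eq]
  simp

/-- **Second derivatives through a linear substitution** (chain rule twice):
`∂_i∂_j (g(My)) = (Σ_{a,b} M_{ai} M_{bj} ∂_a∂_b g)(My)`.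
[cite: MediniShpilka2021, Def 3.6 (chain rule display; arXiv p0017:L49-L51); proof of Lemma 5.15 ("there exist constants `α_{i,j}` …", p0030:L5-L8)] -/
theorem pderiv_pderiv_affSubst_refl (M : Matrix (Fin m) (Fin m) K) (g : MvPolynomial (Fin m) K)
    (i j : Fin m) :
    pderiv i (pderiv j (affSubst le_rfl M 0 g)) =
      affSubst le_rfl M 0 (∑ a, ∑ b, C (M a i * M b j) * pderiv a (pderiv b g)) := by
  rw [pderiv_affSubst, map_sum]
  have hterm : ∀ w : Fin m, pderiv i (affSubst le_rfl M 0 (pderiv w g) * C (M (Fin.castLE le_rfl w) j)) =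
      ∑ v, affSubst le_rfl M 0 (C (M v i * M w j) * pderiv v (pderiv w g)) := by
    intro w
    rw [Derivation.leibniz, pderiv_C, smul_zero, zero_add, smul_eq_mul, pderiv_affSubst,
      Finset.mul_sum]
    refine Finset.sum_congr rfl fun v _ => ?_
    rw [affSubst_mul, affSubst_C, map_mul, Fin.castLE_rfl, id_eq, id_eq]
    ring
  simp_rw [hterm]
  rw [Finset.sum_comm]
  simp only [affSubst, map_sum]

end InnerLinear

/-! ### Absorbing a symmetry: `ANF(α · y_π) = (S_{α ∘ π⁻¹} ANF)(y)` -/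

section Symmetry

variable {K : Type*} [Field K] {N : ℕ}

/-- If `π` is a symmetry of `g` (`g(y_π) = g`), then `g(α · y_π) = S_{α ∘ π⁻¹} g`.
[cite: MediniShpilka2021, §5.2.2 ("up to constant factors, have the same linear functions on the
leaves"; arXiv p0030:L54–L57)] -/
theorem aeval_scale_perm_eq (π : Equiv.Perm (Fin N)) (α : Fin N → K) (g : MvPolynomial (Fin N) K)
    (hπ : rename π g = g) :
    aeval (fun i => C (α i) * X (π i)) g = aeval (fun j => C (α (π.symm j)) * X j) g := by
  have hfun : (fun i => C (α i) * X (π i) : Fin N → MvPolynomial (Fin N) K) =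
      (fun j => C (α (π.symm j)) * X j) ∘ π := by
    funext i
    simp only [Function.comp_apply, Equiv.symm_apply_apply]
  rw [hfun, ← aeval_rename, hπ]

end Symmetry

/-! ### The core at `(K, Δ)` from the three bricks -/

section Core

variable {K : Type} [Field K]

/-- **The homogeneous core of MS Thm 35 at a fixed field `K` and depth `Δ`, from the bricks.**
Hypotheses: `h512` (Lemma 5.12, TR-free form), `h513` (Lemma 5.13 core), `hL2D` (Lemmas 5.14+5.15 as
a second-order engine).  Conclusion: for `M ∈ GL_{4^Δ}(K)` with `ANF_Δ(My) ≠ ANF_Δ(y)` and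
`A ∈ GL_n(K)`, every uniform `(2Δ+7)`-independent `G` hits `(ANF_Δ(My) - ANF_Δ(y))(Ax)`.
Case (ii) (`mon ⊆ mon`): 5.12 + Lemma `pitRoanfSame`; Case (i): 5.13 + chain rule + orbit closure +
two peeled derivatives + 5.14/5.15.
[cite: MediniShpilka2021, proof of Thm 35, `Δ₁ = Δ₂` (arXiv p0030:L33–L55) and §5.2.2 (p0030:L56–p0031:L24)] -/
theorem thm35Core_of_bricks (Δ : ℕ)
    (h512 : ∀ (M : Matrix (Fin (4 ^ Δ)) (Fin (4 ^ Δ)) K), IsUnit M.det →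
      (affSubst le_rfl M 0 (anf K Δ)).support ⊆ (anf K Δ).support →
      ∃ (π : Equiv.Perm (Fin (4 ^ Δ))) (α : Fin (4 ^ Δ) → K), (∀ i, α i ≠ 0) ∧
        rename π (anf K Δ) = anf K Δ ∧
        affSubst le_rfl M 0 (anf K Δ) = aeval (fun i => C (α i) * X (π i)) (anf K Δ))
    (h513 : ∀ (M : Matrix (Fin (4 ^ Δ)) (Fin (4 ^ Δ)) K), IsUnit M.det →
      ¬ (affSubst le_rfl M 0 (anf K Δ)).support ⊆ (anf K Δ).support →
      ∃ i j, pderiv i (pderiv j (anf K Δ)) = 0 ∧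
        pderiv i (pderiv j (affSubst le_rfl M 0 (anf K Δ))) ≠ 0)
    (hL2D : ∀ (n t B c : ℕ) (α : Fin (4 ^ Δ) → Fin (4 ^ Δ) → K),
      (∑ a, ∑ b, C (α a b) * pderiv a (pderiv b (anf K Δ))) ≠ 0 →
      ∀ (h : 4 ^ Δ ≤ n) (A : Matrix (Fin n) (Fin n) K), IsUnit A.det → ∀ (b : Fin n → K),
      4 ^ Δ ≤ 2 ^ t → ∀ (G : Fin n → MvPolynomial (Fin B × (Fin c ⊕ Unit)) K),
      IsIndependent B G → t + 5 ≤ B →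
      bind₁ G (affSubst h A b (∑ a, ∑ b, C (α a b) * pderiv a (pderiv b (anf K Δ)))) ≠ 0) :
    ∀ (n c : ℕ) (h : 4 ^ Δ ≤ n) (A : Matrix (Fin n) (Fin n) K), IsUnit A.det →
      ∀ M : Matrix (Fin (4 ^ Δ)) (Fin (4 ^ Δ)) K, IsUnit M.det →
      affSubst le_rfl M 0 (anf K Δ) ≠ anf K Δ →
      ∀ G : Fin n → MvPolynomial (Fin (2 * max Δ Δ + 7) × (Fin c ⊕ Unit)) K,
        IsIndependent (2 * max Δ Δ + 7) G → IsUniform G →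
        bind₁ G (affSubst h A 0 (affSubst le_rfl M 0 (anf K Δ) - anf K Δ)) ≠ 0 := by
  classical
  intro n c h A hA M hM hne G hG _hU
  have ht : 4 ^ Δ ≤ 2 ^ (2 * Δ) := by rw [pow_mul]; norm_num
  by_cases hsub : (affSubst le_rfl M 0 (anf K Δ)).support ⊆ (anf K Δ).support
  · -- Case (ii): same leaves up to constants — Lemma 5.12 and Lemma pitRoanfSame
    obtain ⟨π, α, hα, hπ, hform⟩ := h512 M hM hsub
    rw [aeval_scale_perm_eq π α _ hπ] at hform
    rw [hform] at hne ⊢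
    exact bind₁_affSubst_scale_anf_sub_anf_ne_zero (fun j => α (π.symm j)) (fun j => hα _) hne h hA
      0 ht G hG (by rw [max_self]; omega)
  · -- Case (i): a separating second derivative — Lemma 5.13, then Lemmas 5.14/5.15 after two peels
    obtain ⟨i, j, hij0, hijne⟩ := h513 M hM hsub
    set P : MvPolynomial (Fin (4 ^ Δ)) K := affSubst le_rfl M 0 (anf K Δ) - anf K Δ with hP
    set D : MvPolynomial (Fin (4 ^ Δ)) K :=
      ∑ a, ∑ b, C (M a i * M b j) * pderiv a (pderiv b (anf K Δ)) with hD
    have hPD : pderiv i (pderiv j P) = affSubst le_rfl M 0 D := by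
      rw [hP, map_sub, map_sub, hij0, sub_zero, pderiv_pderiv_affSubst_refl]
    have hDne : D ≠ 0 := by
      intro h0
      apply hijne
      rw [pderiv_pderiv_affSubst_refl, ← hD, h0]
      simp only [affSubst, map_zero]
    have hfold : (List.ofFn ![i, j]).foldr (fun w p => pderiv w p) P = pderiv i (pderiv j P) := by
      simp [List.ofFn_succ]
    refine hit_affSubst_of_hit_pderivs h ![i, j] (2 * Δ + 5) P ?_ A 0 hA _ c G hG
      (by rw [max_self])
    intro A' b' hA' B c' H hH hB
    rw [hfold, hPD]
    obtain ⟨A'', b'', hA'', hid⟩ := exists_affSubst_affSubst_eq h hA' b' M hM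
    rw [hid]
    exact hL2D n (2 * Δ) B c' (fun a b => M a i * M b j) hDne h A'' hA'' b'' ht H hH (by omega)

/-- **MS Thm 35 at `(K, Δ, Δ)` from the core at `(K, Δ)`** — the case analysis of
`MS2021_thm_35_of_core`, field by field: spans differ (`MS2021_thm_35_of_offBlock`); spans equal
(`exists_rowMatrix_of_offBlock_eq_zero`) and `M` a symmetry (`MS2021_thm_35_of_rowSpan_symm`);
otherwise the top component `(ANF(My) - ANF(y))(A₂x)` is the core, and degree separation under the
uniform `G` concludes. [cite: MediniShpilka2021, Thm 35 (CCC p.19:13; arXiv p0008:L29-30) and its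
proof (arXiv p0030:L28–p0031:L24)] -/
theorem thm35_sameDepth_of_core (Δ : ℕ)
    (hcore : ∀ (n c : ℕ) (h : 4 ^ Δ ≤ n) (A : Matrix (Fin n) (Fin n) K), IsUnit A.det →
      ∀ M : Matrix (Fin (4 ^ Δ)) (Fin (4 ^ Δ)) K, IsUnit M.det →
      affSubst le_rfl M 0 (anf K Δ) ≠ anf K Δ →
      ∀ G : Fin n → MvPolynomial (Fin (2 * max Δ Δ + 7) × (Fin c ⊕ Unit)) K,
        IsIndependent (2 * max Δ Δ + 7) G → IsUniform G →
        bind₁ G (affSubst h A 0 (affSubst le_rfl M 0 (anf K Δ) - anf K Δ)) ≠ 0) (n c : ℕ) :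
    ∀ f₁ ∈ affOrbit n (anf K Δ), ∀ f₂ ∈ affOrbit n (anf K Δ), f₁ - f₂ ≠ 0 →
      ∀ G : Fin n → MvPolynomial (Fin (2 * max Δ Δ + 7) × (Fin c ⊕ Unit)) K,
        IsIndependent (2 * max Δ Δ + 7) G → IsUniform G → bind₁ G (f₁ - f₂) ≠ 0 := by
  intro f₁ hf₁ f₂ hf₂ hne G hG hU
  obtain ⟨h, A₁, b₁, hA₁, rfl⟩ := hf₁
  obtain ⟨h', A₂, b₂, hA₂, rfl⟩ := hf₂
  have hh : affSubst h' A₂ b₂ (anf K Δ) = affSubst h A₂ b₂ (anf K Δ) := rfl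
  rw [hh] at hne ⊢
  classical
  by_cases hoff : ∃ (i₀ : Fin (4 ^ Δ)) (j₁ : Fin n), 4 ^ Δ ≤ (j₁ : ℕ) ∧
      ((A₁ * A₂⁻¹) (Fin.castLE h i₀) j₁ ≠ 0 ∨ (A₂ * A₁⁻¹) (Fin.castLE h i₀) j₁ ≠ 0)
  · exact MS2021_thm_35_of_offBlock K n Δ c h hA₁ hA₂ b₁ b₂ hoff G hG
  push Not at hoff
  obtain ⟨M, hM, hrows⟩ := exists_rowMatrix_of_offBlock_eq_zero h hA₁ hA₂
    (fun i l hl => (hoff i l hl).1)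
  by_cases hsym : affSubst le_rfl M 0 (anf K Δ) = anf K Δ
  · exact MS2021_thm_35_of_rowSpan_symm K n Δ c h hA₂ b₁ b₂ M hM hrows hsym hne G hG hU
  have hn : 0 < n := lt_of_lt_of_le (Nat.one_le_pow _ _ (by norm_num)) h
  obtain ⟨e, he, hGe⟩ := exists_pos_isHomogeneous_of_isUniform hG hU (by omega) ⟨0, hn⟩
  refine bind₁_ne_zero_of_homogeneousComponent hGe he (j := 2 ^ Δ) ?_
  have h0 : (fun i : Fin (4 ^ Δ) => (0 : Fin n → K) (Fin.castLE h i)) = 0 := rfl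
  rw [map_sub, homogeneousComponent_affSubst h A₁ b₁ (isHomogeneous_anf K Δ),
    homogeneousComponent_affSubst h A₂ b₂ (isHomogeneous_anf K Δ),
    affSubst_eq_affSubst_zero_affSubst h 0 M hrows (anf K Δ), h0, ← affSubst_sub]
  exact hcore n c h A₂ hA₂ M hM hsym G hG hU

end Core

end MS2021

/-! ### Packaging: Thm 35 from the bricks, per field and for all fields -/

section Packaging

open MS2021

/-- **MS Thm 35 at `(K, Δ, Δ)` from the three §5.2 bricks at `(K, Δ)`** (Lemma 5.12 TR-free form,
Lemma 5.13 core, Lemmas 5.14+5.15 engine — explicit hypotheses, see the module docstring); the case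
`Δ₁ ≠ Δ₂` is `MS2021_thm_35_of_ne` unconditionally.
[cite: MediniShpilka2021, Thm 35 (CCC p.19:13; arXiv p0008:L29-30); proof §5.2 (arXiv p0030:L28–p0031:L24)] -/
theorem MS2021_thm_35_sameDepth_of_bricks (K : Type) [Field K] (Δ : ℕ)
    (h512 : ∀ (M : Matrix (Fin (4 ^ Δ)) (Fin (4 ^ Δ)) K), IsUnit M.det →
      (affSubst le_rfl M 0 (anf K Δ)).support ⊆ (anf K Δ).support →
      ∃ (π : Equiv.Perm (Fin (4 ^ Δ))) (α : Fin (4 ^ Δ) → K), (∀ i, α i ≠ 0) ∧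
        rename π (anf K Δ) = anf K Δ ∧
        affSubst le_rfl M 0 (anf K Δ) = aeval (fun i => C (α i) * X (π i)) (anf K Δ))
    (h513 : ∀ (M : Matrix (Fin (4 ^ Δ)) (Fin (4 ^ Δ)) K), IsUnit M.det →
      ¬ (affSubst le_rfl M 0 (anf K Δ)).support ⊆ (anf K Δ).support →
      ∃ i j, pderiv i (pderiv j (anf K Δ)) = 0 ∧
        pderiv i (pderiv j (affSubst le_rfl M 0 (anf K Δ))) ≠ 0)
    (hL2D : ∀ (n t B c : ℕ) (α : Fin (4 ^ Δ) → Fin (4 ^ Δ) → K),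
      (∑ a, ∑ b, C (α a b) * pderiv a (pderiv b (anf K Δ))) ≠ 0 →
      ∀ (h : 4 ^ Δ ≤ n) (A : Matrix (Fin n) (Fin n) K), IsUnit A.det → ∀ (b : Fin n → K),
      4 ^ Δ ≤ 2 ^ t → ∀ (G : Fin n → MvPolynomial (Fin B × (Fin c ⊕ Unit)) K),
      IsIndependent B G → t + 5 ≤ B →
      bind₁ G (affSubst h A b (∑ a, ∑ b, C (α a b) * pderiv a (pderiv b (anf K Δ)))) ≠ 0)
    (n c : ℕ) :
    ∀ f₁ ∈ affOrbit n (anf K Δ), ∀ f₂ ∈ affOrbit n (anf K Δ), f₁ - f₂ ≠ 0 →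
      ∀ G : Fin n → MvPolynomial (Fin (2 * max Δ Δ + 7) × (Fin c ⊕ Unit)) K,
        IsIndependent (2 * max Δ Δ + 7) G → IsUniform G → bind₁ G (f₁ - f₂) ≠ 0 :=
  thm35_sameDepth_of_core Δ (thm35Core_of_bricks Δ h512 h513 hL2D) n c

/-- **MS Thm 35 at `(K, Δ, Δ)` for `char K = 0` or `char K > 2^Δ` from Lemma 5.12 and Lemmas
5.14+5.15 alone**: the Lemma 5.13 brick is the tree's `exists_pderiv_pderiv_anf_separates_linSubst`
under the exponent hypothesis `hK`. [cite: MediniShpilka2021, Thm 35 (CCC p.19:13); Lemma 5.13 (arXiv p0029:L3-L13)] -/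
theorem MS2021_thm_35_sameDepth_of_bricks_of_cast_ne_zero (K : Type) [Field K] (Δ : ℕ)
    (hK : ∀ m : ℕ, 1 ≤ m → m ≤ 2 ^ Δ → (m : K) ≠ 0)
    (h512 : ∀ (M : Matrix (Fin (4 ^ Δ)) (Fin (4 ^ Δ)) K), IsUnit M.det →
      (affSubst le_rfl M 0 (anf K Δ)).support ⊆ (anf K Δ).support →
      ∃ (π : Equiv.Perm (Fin (4 ^ Δ))) (α : Fin (4 ^ Δ) → K), (∀ i, α i ≠ 0) ∧
        rename π (anf K Δ) = anf K Δ ∧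
        affSubst le_rfl M 0 (anf K Δ) = aeval (fun i => C (α i) * X (π i)) (anf K Δ))
    (hL2D : ∀ (n t B c : ℕ) (α : Fin (4 ^ Δ) → Fin (4 ^ Δ) → K),
      (∑ a, ∑ b, C (α a b) * pderiv a (pderiv b (anf K Δ))) ≠ 0 →
      ∀ (h : 4 ^ Δ ≤ n) (A : Matrix (Fin n) (Fin n) K), IsUnit A.det → ∀ (b : Fin n → K),
      4 ^ Δ ≤ 2 ^ t → ∀ (G : Fin n → MvPolynomial (Fin B × (Fin c ⊕ Unit)) K),
      IsIndependent B G → t + 5 ≤ B →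
      bind₁ G (affSubst h A b (∑ a, ∑ b, C (α a b) * pderiv a (pderiv b (anf K Δ)))) ≠ 0)
    (n c : ℕ) :
    ∀ f₁ ∈ affOrbit n (anf K Δ), ∀ f₂ ∈ affOrbit n (anf K Δ), f₁ - f₂ ≠ 0 →
      ∀ G : Fin n → MvPolynomial (Fin (2 * max Δ Δ + 7) × (Fin c ⊕ Unit)) K,
        IsIndependent (2 * max Δ Δ + 7) G → IsUniform G → bind₁ G (f₁ - f₂) ≠ 0 :=
  MS2021_thm_35_sameDepth_of_bricks K Δ h512
    (fun M _ hsub => exists_pderiv_pderiv_anf_separates_linSubst K Δ hK M hsub) hL2D n c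

/-- **MS Thm 35 (all fields, all depths) from the three bricks for every field and depth.**
[cite: MediniShpilka2021, Thm 35 (CCC p.19:13; arXiv p0008:L29-30); proof §5.2 (arXiv p0030:L28–p0031:L24)] -/
theorem MS2021_thm_35_of_bricks
    (h512 : ∀ (K : Type) [Field K] (Δ : ℕ) (M : Matrix (Fin (4 ^ Δ)) (Fin (4 ^ Δ)) K),
      IsUnit M.det → (affSubst le_rfl M 0 (anf K Δ)).support ⊆ (anf K Δ).support →
      ∃ (π : Equiv.Perm (Fin (4 ^ Δ))) (α : Fin (4 ^ Δ) → K), (∀ i, α i ≠ 0) ∧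
        rename π (anf K Δ) = anf K Δ ∧
        affSubst le_rfl M 0 (anf K Δ) = aeval (fun i => C (α i) * X (π i)) (anf K Δ))
    (h513 : ∀ (K : Type) [Field K] (Δ : ℕ) (M : Matrix (Fin (4 ^ Δ)) (Fin (4 ^ Δ)) K),
      IsUnit M.det → ¬ (affSubst le_rfl M 0 (anf K Δ)).support ⊆ (anf K Δ).support →
      ∃ i j, pderiv i (pderiv j (anf K Δ)) = 0 ∧
        pderiv i (pderiv j (affSubst le_rfl M 0 (anf K Δ))) ≠ 0)
    (hL2D : ∀ (K : Type) [Field K] (Δ n t B c : ℕ) (α : Fin (4 ^ Δ) → Fin (4 ^ Δ) → K),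
      (∑ a, ∑ b, C (α a b) * pderiv a (pderiv b (anf K Δ))) ≠ 0 →
      ∀ (h : 4 ^ Δ ≤ n) (A : Matrix (Fin n) (Fin n) K), IsUnit A.det → ∀ (b : Fin n → K),
      4 ^ Δ ≤ 2 ^ t → ∀ (G : Fin n → MvPolynomial (Fin B × (Fin c ⊕ Unit)) K),
      IsIndependent B G → t + 5 ≤ B →
      bind₁ G (affSubst h A b (∑ a, ∑ b, C (α a b) * pderiv a (pderiv b (anf K Δ)))) ≠ 0) :
    MS2021_thm_35 :=
  MS2021_thm_35_of_core fun K _ n Δ c h A hA M hM hne G hG hU =>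
    thm35Core_of_bricks Δ (h512 K Δ) (h513 K Δ) (hL2D K Δ) n c h A hA M hM hne G hG hU

end Packaging

end Literature.Computability.AlgebraicComplexity

end
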